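import Summits.AtomisticToContinuum.Crystallization.Theorems.SquareWellLayerCakeStackingFaultSparsityQualitativeRigidity

/-!
# Strategist split of the crux `StackingFaultSparsity` (stmt-AtomisticToContinuum-14296) — Theorems-ready glue

Crux-strategist s2 (planner-cstrat-stmt-AtomisticToContinuum-14296-s2-0), 2026-08-17.  This file is the
kernel-checked package behind `Cruxes/StackingFaultSparsity/SPLIT-READY.md`: the typed decomposition

  `StackingFaultSparsity ⇐ GoodLaminarWindowsAE ∧ QualitativeLaminarRigidity`

of the route `LaminarSixThreeThree` copy of the crux, with

* `GoodLaminarWindowsAE` — GOOD laminar `6 + 3 + 3` windows almost everywhere along every sequence of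
  Lennard-Jones ground states, at every radius `R ≥ 2` and tolerance `ε > 0`: VERBATIM the consequent of
  item stmt-14294 `LaminarSaturation` (= `LjLaminarity → GoodLaminarWindowsAE`), hence the hinge
  `LjLaminarity ∧ LaminarSaturation` discharged (`goodLaminarWindowsAE_of_cruxes`; conversely
  `ljLaminarity_of_goodLaminarWindowsAE`, so the hinge is EQUIVALENT to the pair of cruxes 2 + 3);
* `QualitativeLaminarRigidity` — VERBATIM the registered stub `stub_qualitativeRigidity` of line `Sketch`
  (reshape 10), LANDED by lead c7 (p150153): for every `R`, `ε > 0` some scale `k` makes every GOOD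
  `(k + 2, 1/(k + 1))`-window of every finite configuration `(R, ε)`-Barlow-matched;
* the glue `StackingFaultSparsity_of_subs : GoodLaminarWindowsAE → QualitativeLaminarRigidity →
  StackingFaultSparsity`, which USES both hypotheses (the rigidity scale `k(R, ε)` + `Nat.card` comparison
  give `LaminarBarlowWindows`, item 14292; then the landed selection
  `StackingFaultSparsity_of_laminarBarlowWindows'`, p141795) — the body of the lead's
  `laminarBarlowWindows_of_goodWindowsAE` with the rigidity as a hypothesis instead of the landed theorem.

A planner cannot land Theorems files; a prover who lands this file verbatim as
`Summits/AtomisticToContinuum/Crystallization/Theorems/LaminarSixThreeThreeStackingFaultSparsitySplit.lean`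
(`--supports stmt-AtomisticToContinuum-14296`) closes the generated glue item and the child
`QualitativeLaminarRigidity` of the split by the one-liners below.  No `sorry`; Mathlib + the one import.
-/

noncomputable section

namespace Summit.AtomisticToContinuum.Crystallization.Cruxes.StackingFaultSparsity.StrategistSplit

open Literature.MathematicalPhysics.StatisticalMechanics Filter
open Summit.AtomisticToContinuum.Crystallization.Theses.LaminarSixThreeThree (LjLaminarity LaminarSaturation
  LaminarBarlowWindows)

/-- **Child 1 — GOOD laminar windows a.e.** (the consequent of item stmt-14294 `LaminarSaturation`, verbatim):
for every `R ≥ 2` and `ε > 0`, along every sequence of LJ ground states the fraction of particles `i` without a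
GOOD `(R, ε)`-window (bond lengths `a, b ∈ [19/20, 1]`, a unit normal, `ε`-flat integer-indexed levels with gaps
`≥ 19/25` on `B(x i, R)`, separation `≥ 19/20` there, exactly `6 + 3 + 3` partners within distance `1` with
`ε`-sharp lengths at every particle of `B(x i, R/2)`) tends to `0`. [folklore] -/
def GoodLaminarWindowsAE : Prop :=
  ∀ R ε : ℝ, 2 ≤ R → 0 < ε → ∀ x : (N : ℕ) → (Fin N → EuclideanSpace ℝ (Fin 3)), (∀ N, Literature.MathematicalPhysics.StatisticalMechanics.IsGroundState Literature.MathematicalPhysics.StatisticalMechanics.lennardJones (x N)) → Filter.Tendsto (fun N : ℕ => (Nat.card {i : Fin N // ¬ (∃ a b : ℝ, 19 / 20 ≤ a ∧ a ≤ 1 ∧ 19 / 20 ≤ b ∧ b ≤ 1 ∧ ∃ n : EuclideanSpace ℝ (Fin 3), ‖n‖ = 1 ∧ ∃ c : ℤ → ℝ, (∀ k : ℤ, c k + 19 / 25 ≤ c (k + 1)) ∧ ∃ l : Fin N → ℤ, (∀ j : Fin N, dist (x N j) (x N i) ≤ R → |inner ℝ (x N j - x N i) n - c (l j)| ≤ ε)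 ∧ (∀ j k : Fin N, dist (x N j) (x N i) ≤ R → dist (x N k) (x N i) ≤ R → j ≠ k → 19 / 20 ≤ dist (x N j) (x N k)) ∧ ∀ j : Fin N, dist (x N j) (x N i) ≤ R / 2 → Nat.card {k : Fin N // k ≠ j ∧ l k = l j ∧ dist (x N j) (x N k) ≤ 1} = 6 ∧ Nat.card {k : Fin N // l k = l j + 1 ∧ dist (x N j) (x N k) ≤ 1} = 3 ∧ Nat.card {k : Fin N // l k = l j - 1 ∧ dist (x N j) (x N k) ≤ 1} = 3 ∧ ∀ k : Fin N, k ≠ j → dist (x N j) (x N k) ≤ 1 → (l k = l j → |dist (x N j) (x N k) - a| ≤ ε) ∧ (l k ≠ l j → |dist (x N j) (x N k) - b| ≤ ε))} : ℝ) / N) Filter.atTop (nhds 0)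

/-- **Child 2 — qualitative laminar rigidity** (the registered stub `stub_qualitativeRigidity` of line `Sketch`,
verbatim; LANDED p150153): for every `R` and `ε > 0` there is a scale `kk` such that every GOOD
`(kk + 2, 1/(kk + 1))`-window of every finite configuration is two-way `ε`-matched on `B(x i, R)`, after a linear
isometry, to a window of some `barlowStacking a h s` (`a, h ∈ (1/2, 2)`, `s` a Hägg word). [folklore] -/
def QualitativeLaminarRigidity : Prop :=
  ∀ R ε : ℝ, 0 < ε → ∃ kk : ℕ, ∀ (N : ℕ) (x : Fin N → EuclideanSpace ℝ (Fin 3)) (i : Fin N), (∃ a b : ℝ, 19 / 20 ≤ a ∧ a ≤ 1 ∧ 19 / 20 ≤ b ∧ b ≤ 1 ∧ ∃ n : EuclideanSpace ℝ (Fin 3), ‖n‖ = 1 ∧ ∃ c : ℤ → ℝ, (∀ k : ℤ, c k + 19 / 25 ≤ c (k + 1)) ∧ ∃ l : Fin N → ℤ, (∀ j : Fin N, dist (x j) (x i) ≤ (kk : ℝ) + 2 → |inner ℝ (x j - x i) n - c (l j)| ≤ 1 / ((kk : ℝ) + 1)) ∧ (∀ j k : Fin N, dist (x j) (x i) ≤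 (kk : ℝ) + 2 → dist (x k) (x i) ≤ (kk : ℝ) + 2 → j ≠ k → 19 / 20 ≤ dist (x j) (x k)) ∧ ∀ j : Fin N, dist (x j) (x i) ≤ ((kk : ℝ) + 2) / 2 → Nat.card {k : Fin N // k ≠ j ∧ l k = l j ∧ dist (x j) (x k) ≤ 1} = 6 ∧ Nat.card {k : Fin N // l k = l j + 1 ∧ dist (x j) (x k) ≤ 1} = 3 ∧ Nat.card {k : Fin N // l k = l j - 1 ∧ dist (x j) (x k) ≤ 1} = 3 ∧ ∀ k : Fin N, k ≠ j → dist (x j) (x k) ≤ 1 → (l k = l j → |dist (x j) (x k) - a| ≤ 1 / ((kk : ℝ) + 1)) ∧ (l k ≠ l j → |dist (x j) (x k) - b| ≤ 1 / ((kk : ℝ) + 1))) → ∃ a h : ℝ, 1 / 2 < a ∧ a < 2 ∧ 1 / 2 < h ∧ h < 2 ∧ ∃ s : ℤ → ℤ, Literature.MathematicalPhysics.StatisticalMechanics.IsHaggSeq s ∧ ∃ z ∈ Literature.MathematicalPhysics.StatisticalMechanics.barlowStacking a h s, ∃ A : EuclideanSpace ℝ (Fin 3) →ₗᵢ[ℝ]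 EuclideanSpace ℝ (Fin 3), (∀ p ∈ Literature.MathematicalPhysics.StatisticalMechanics.barlowStacking a h s, dist p z ≤ R → ∃ j : Fin N, dist (x j) (x i + A (p - z)) ≤ ε) ∧ (∀ j : Fin N, dist (x j) (x i) ≤ R → ∃ p ∈ Literature.MathematicalPhysics.StatisticalMechanics.barlowStacking a h s, dist (x j) (x i + A (p - z)) ≤ ε)

/-- **Item 14292 from the two children** (the glue's first half; uses BOTH hypotheses): at the target `(R, ε)`
take the scale `kk` of the rigidity; the non-Barlow-matched particles are among those without a GOOD
`(kk + 2, 1/(kk + 1))`-window. [folklore] -/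
theorem laminarBarlowWindows_of_subs (hG : GoodLaminarWindowsAE) (hQ : QualitativeLaminarRigidity) :
    LaminarBarlowWindows := by
  intro R ε _hR hε _hε4 x hx
  obtain ⟨kk, hk⟩ := hQ R ε hε
  have h2 : (2 : ℝ) ≤ (kk : ℝ) + 2 := by linarith [(Nat.cast_nonneg kk : (0 : ℝ) ≤ kk)]
  have hT := hG ((kk : ℝ) + 2) (1 / ((kk : ℝ) + 1)) h2 (by positivity) x hx
  refine squeeze_zero (fun N => by positivity) (fun N => ?_) hT
  refine div_le_div_of_nonneg_right (Nat.cast_le.mpr ?_) (Nat.cast_nonneg N)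
  refine Nat.card_le_card_of_injective
    (Subtype.map id fun i hi hgood => hi ?_) (Subtype.map_injective _ Function.injective_id)
  exact hk N (x N) i hgood

/-- **The split glue** `GoodLaminarWindowsAE → QualitativeLaminarRigidity → StackingFaultSparsity` (route
`LaminarSixThreeThree` copy of the crux): item 14292 from the children, then the landed selection step
`StackingFaultSparsity_of_laminarBarlowWindows'` (p141795). [folklore] -/
theorem StackingFaultSparsity_of_subs :
    GoodLaminarWindowsAE → QualitativeLaminarRigidity →
      Summit.AtomisticToContinuum.Crystallization.Theses.LaminarSixThreeThree.StackingFaultSparsity :=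
  fun hG hQ =>
    Summit.AtomisticToContinuum.Crystallization.Theorems.SquareWellLayerCake.StackingFaultSparsity.OfLaminarBarlowWindows.StackingFaultSparsity_of_laminarBarlowWindows'
      (laminarBarlowWindows_of_subs hG hQ)

/-- The same glue for the sibling route `SquareWellLayerCake`'s copy of the crux (syntactically identical decl).
[folklore] -/
theorem StackingFaultSparsity_of_subs' :
    GoodLaminarWindowsAE → QualitativeLaminarRigidity →
      Summit.AtomisticToContinuum.Crystallization.Theses.SquareWellLayerCake.StackingFaultSparsity :=
  fun hG hQ =>
    Summit.AtomisticToContinuum.Crystallization.Theorems.SquareWellLayerCake.StackingFaultSparsity.OfLaminarBarlowWindows.StackingFaultSparsity_of_laminarBarlowWindows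
      (laminarBarlowWindows_of_subs hG hQ)

/-- **Child 2 holds** (landed, p150153). [folklore] -/
theorem qualitativeLaminarRigidity_holds : QualitativeLaminarRigidity :=
  Summit.AtomisticToContinuum.Crystallization.Theorems.SquareWellLayerCake.StackingFaultSparsity.QualitativeRigidity.stub_qualitativeRigidity

/-- **Child 1 from cruxes 2 ∧ 3** (`LjLaminarity`, `LaminarSaturation`): modus ponens. [folklore] -/
theorem goodLaminarWindowsAE_of_cruxes (h14293 : LjLaminarity) (h14294 : LaminarSaturation) :
    GoodLaminarWindowsAE :=
  h14294 h14293

/-- **Child 1 gives back crux 2** (`LjLaminarity`): a GOOD `(max R 2, t)`-window is a laminar `(R, t)`-window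
(levels with gaps `≥ 19/25 ≥ 3/4`, flatness `t`), so the non-laminar particles are among the non-GOOD ones.  With
`goodLaminarWindowsAE_of_cruxes` this shows the hinge is EQUIVALENT to `LjLaminarity ∧ LaminarSaturation`.
[folklore] -/
theorem ljLaminarity_of_goodLaminarWindowsAE (hG : GoodLaminarWindowsAE) : LjLaminarity := by
  intro t R ht _hR x hx
  have hT := hG (max R 2) t (le_max_right _ _) ht x hx
  refine squeeze_zero (fun N => by positivity) (fun N => ?_) hT
  refine div_le_div_of_nonneg_right (Nat.cast_le.mpr ?_) (Nat.cast_nonneg N)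
  refine Nat.card_le_card_of_injective
    (Subtype.map id fun i hi hgood => hi ?_) (Subtype.map_injective _ Function.injective_id)
  obtain ⟨a, b, -, -, -, -, n, hn, c, hc, l, hl, -, -⟩ := hgood
  exact ⟨n, hn, c, fun k => by linarith [hc k], fun j hj => ⟨l j, hl j (hj.trans (le_max_left _ _))⟩⟩

/-- **Crux 3 from child 1** (trivially: `LaminarSaturation = (LjLaminarity → GoodLaminarWindowsAE)`). [folklore] -/
theorem laminarSaturation_of_goodLaminarWindowsAE (hG : GoodLaminarWindowsAE) : LaminarSaturation :=
  fun _ => hG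

/-! ## Simulation of the gate's rendering of the split (glue item statement, verbatim shape) -/

example : (GoodLaminarWindowsAE → QualitativeLaminarRigidity →
    Summit.AtomisticToContinuum.Crystallization.Theses.LaminarSixThreeThree.StackingFaultSparsity) :=
  StackingFaultSparsity_of_subs

end Summit.AtomisticToContinuum.Crystallization.Cruxes.StackingFaultSparsity.StrategistSplit

end
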